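import Summits.CriticalPhenomena.CardyFormulaZ2.Theorems.CardyIKTransportIKLinearTransportScreeningAssemblyGeo
import Summits.CriticalPhenomena.CardyFormulaZ2.Theorems.CardyIKTransportIKLinearTransportScreeningAssemblyProb
import Summits.CriticalPhenomena.CardyFormulaZ2.Theorems.CardyIKTransportIKLinearTransportScreeningAssemblyAna
import Summits.CriticalPhenomena.CardyFormulaZ2.Theorems.CardyIKTransportIKLinearTransportScreeningArray2
import Summits.CriticalPhenomena.CardyFormulaZ2.Theorems.CardyIKTransportIKLinearTransportScreeningArray4
import Summits.CriticalPhenomena.CardyFormulaZ2.Theorems.CardyIKTransportIKLinearTransportScreeningGlue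

/-!
# `stub_Screening` PROVED (crux stmt-CriticalPhenomena-5076 `CardyIKTransport.IKLinearTransport`, line
# `pinned-diagram-exchange`): far-field ratio weak mixing of the gauge colour field

Theorem-only file (`--supports stmt-CriticalPhenomena-5076`; proves the registered stub `stub_Screening` by name
and signature). ASSEMBLY (lead seat c1 with its wave-2 worker) of the landed pieces: the finite-array estimates
`screeningArray` (p119372) / `screeningOffset` (p118204), the gauge identities after the anchored shear
(`…ScreeningGauge.lean`, p117282), the assembly vocabulary (`…ScreeningAssemblyDefs.lean`, p119854) and its
sub-goals (`…ScreeningAssemblyGeo.lean` p120540: far/box agreement, environment-only reading, additive offsets;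
`…ScreeningAssemblyProb.lean` p120757: measurability, independence + discrete laws; `…ScreeningAssemblyAna.lean`
p120454: the error tends to zero).

STATEMENT: for every `ε > 0` there is `N` such that for all `n ≥ N`, every column pattern `S`, every `w × h` box
with `w, h ≤ 2n`, every measurable event `E` determined by the cells at sup-distance `≥ n` from the box and every
measurable event `L` determined by the box, `|ν_S(E ∩ L) − ν_S(E) ν_S(L)| ≤ ε ν_S(E)`.
PROOF: pull back along the μIK-preserving shear; on Ω the event `E` reads (environment, parities of the internal
plaquette array `Qarr`) and `L` reads (environment, tail parities `boxData (Qarr)`, box coins), the environment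
entering `L` through an additive offset only; integrate out `Qarr` and the coins (independence, explicit weights
`arrWeight (pcol …)`), apply `screeningArray` fibrewise in the parity value (ratio form, error `2σ*`) and
`screeningOffset` to compare the box functional across environments (error `(w+h)θ^n`), and conclude with
`screening_error_small` (`2σ* + (w+h)θ^n ≤ ε`, `σ* ≤ 1` from `N(ε)` on).
-/

noncomputable section

namespace Summit.CriticalPhenomena.CardyFormulaZ2.Theorems.IKLinearTransport.PinnedDiagramExchange.ScreeningAssembly

open scoped Classical symmDiff BigOperators
open MeasureTheory ProbabilityTheory Set
open Literature.Probability.Percolation Literature.Probability.LatticeModels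
open ScreeningGauge ScreeningArray

/-! ## §5 Assembly

The registered stub `stub_Screening` from the sub-goals of §2–§4, the landed finite-array estimates
`screeningArray` (p119372) / `screeningOffset` (p118204), the gauge identities (`screenShear_measurePreserving`,
p117282) and `pcol_props` (p119854). Organisation: §5.1 finite bookkeeping (coin averages, parity fibres, the
pointwise screening bound), §5.2 the abstract endgame on a probability space, §5.3 integrating out the internal
plaquettes and the box coins, §5.4 the screening inequality for synthetic indicators, §5.5 indicators of
pulled-back events, §5.6 the stub (in the line namespace). -/

/-! ### §5.1 Finite bookkeeping -/

/-- The coin average has total mass one: `Σ_cc 2^{-wh} = 1`. [folklore] -/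
theorem sum_half_pow : ∀ (w h : ℕ), ∑ _cc : Fin w × Fin h → Bool, (1 / 2 : ℝ) ^ (w * h) = 1 := by
  intro w h
  rw [Finset.sum_const, Finset.card_univ, Fintype.card_fun, Fintype.card_bool, Fintype.card_prod,
    Fintype.card_fin, Fintype.card_fin, nsmul_eq_mul]
  push_cast
  rw [← mul_pow]
  norm_num

/-- A coin average of `[0, 1]`-valued quantities lies in `[0, 1]`. [folklore] -/
theorem coinAvg_mem (w h : ℕ) (g : (Fin w × Fin h → Bool) → ℝ) (hg : ∀ cc, 0 ≤ g cc ∧ g cc ≤ 1) :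
    0 ≤ ∑ cc, (1 / 2 : ℝ) ^ (w * h) * g cc ∧ ∑ cc, (1 / 2 : ℝ) ^ (w * h) * g cc ≤ 1 := by
  refine ⟨Finset.sum_nonneg fun cc _ => mul_nonneg (pow_nonneg (by norm_num) _) (hg cc).1, ?_⟩
  calc ∑ cc, (1 / 2 : ℝ) ^ (w * h) * g cc
      ≤ ∑ _cc : Fin w × Fin h → Bool, (1 / 2 : ℝ) ^ (w * h) :=
        Finset.sum_le_sum fun cc _ => mul_le_of_le_one_right (pow_nonneg (by norm_num) _) (hg cc).2
    _ = 1 := sum_half_pow w h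

/-- The box data read only the upper-right entries `{f | n ≤ f.1 ∧ n ≤ f.2}` of the array. [folklore] -/
theorem boxData_congr {m k : ℕ} (n w h : ℕ) (q q' : Fin m × Fin k → Bool)
    (hqq' : ∀ f : Fin m × Fin k, n ≤ (f.1 : ℕ) → n ≤ (f.2 : ℕ) → q f = q' f) :
    boxData n w h q = boxData n w h q' := by
  funext ij
  unfold boxData tailPar
  have hfil : (Finset.univ.filter fun f : Fin m × Fin k =>
      n + (ij.1 : ℕ) ≤ (f.1 : ℕ) ∧ n + (ij.2 : ℕ) ≤ (f.2 : ℕ) ∧ q f = true) =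
      Finset.univ.filter fun f : Fin m × Fin k =>
        n + (ij.1 : ℕ) ≤ (f.1 : ℕ) ∧ n + (ij.2 : ℕ) ≤ (f.2 : ℕ) ∧ q' f = true := by
    ext f
    simp only [Finset.mem_filter, Finset.mem_univ, true_and]
    constructor
    · rintro ⟨h1, h2, h3⟩
      exact ⟨h1, h2, by rwa [← hqq' f (by omega) (by omega)]⟩
    · rintro ⟨h1, h2, h3⟩
      exact ⟨h1, h2, by rwa [hqq' f (by omega) (by omega)]⟩
  rw [hfil]

/-- Fibrewise decomposition of a weighted array sum along the parity classes `kk = parities q`. [folklore] -/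
theorem arrSum_fiber {m k : ℕ} (p : Fin m → ℝ) (env : (Fin m → Bool) × (Fin k → Bool) → ℝ)
    (G : (Fin m × Fin k → Bool) → ℝ) :
    arrSum p (fun q => env (parities q) * G q) =
      ∑ kk : (Fin m → Bool) × (Fin k → Bool),
        env kk * arrSum p (fun q => if parities q = kk then G q else 0) := by
  unfold arrSum
  simp_rw [Finset.mul_sum]
  rw [Finset.sum_comm]
  refine Finset.sum_congr rfl fun q _ => ?_
  rw [Finset.sum_eq_single (parities q)]
  · rw [if_pos rfl]
    ring
  · intro kk _ hkk
    rw [if_neg (Ne.symm hkk)]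
    ring
  · intro hq
    exact absurd (Finset.mem_univ _) hq

/-- SCREENING, pointwise in the environment (from the landed `screeningArray`): for a `[0, 1]`-valued
UR-determined statistic `F` of the array and nonnegative parity weights `env`,
`|E[env(parities) F] − E[env(parities)] E[F]| ≤ 2 Σ* · E[env(parities)]` (sum the fibrewise bounds). [folklore] -/
theorem screening_pointwise (m k n : ℕ) (hn : 1 ≤ n) (hnm : n ≤ m) (hnk : n ≤ k) (p : Fin m → ℝ) (θ : ℝ)
    (hp : ∀ c, 0 ≤ p c ∧ p c ≤ 1) (hθ0 : 0 ≤ θ) (hθ1 : θ ≤ 1) (hpθ : ∀ c, |1 - 2 * p c| ≤ θ)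
    (hσ : sigmaStar m k n θ ≤ 1) (F : (Fin m × Fin k → Bool) → ℝ) (hF : ∀ q, 0 ≤ F q ∧ F q ≤ 1)
    (hFdet : ∀ q q' : Fin m × Fin k → Bool,
      (∀ f : Fin m × Fin k, n ≤ (f.1 : ℕ) → n ≤ (f.2 : ℕ) → q f = q' f) → F q = F q')
    (env : (Fin m → Bool) × (Fin k → Bool) → ℝ) (henv : ∀ kk, 0 ≤ env kk) :
    |arrSum p (fun q => env (parities q) * F q) - arrSum p (fun q => env (parities q)) * arrSum p F| ≤
      2 * sigmaStar m k n θ * arrSum p (fun q => env (parities q)) := by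
  have h1 := arrSum_fiber p env F
  have h2 : arrSum p (fun q => env (parities q)) = ∑ kk : (Fin m → Bool) × (Fin k → Bool),
      env kk * arrSum p (fun q => if parities q = kk then 1 else 0) := by
    have h := arrSum_fiber p env (fun _ => 1)
    simp only [mul_one] at h
    exact h
  rw [h1, h2, Finset.sum_mul, Finset.mul_sum, ← Finset.sum_sub_distrib]
  refine (Finset.abs_sum_le_sum_abs _ _).trans (Finset.sum_le_sum fun kk _ => ?_)
  have hA := screeningArray m k n hn hnm hnk p θ hp hθ0 hθ1 hpθ hσ F hF hFdet kk
  have heq : env kk * arrSum p (fun q => if parities q = kk then F q else 0) -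
      env kk * arrSum p (fun q => if parities q = kk then 1 else 0) * arrSum p F =
      env kk * (arrSum p (fun q => if parities q = kk then F q else 0) -
        arrSum p F * arrSum p (fun q => if parities q = kk then 1 else 0)) := by ring
  rw [heq, abs_mul, abs_of_nonneg (henv kk)]
  calc env kk * |arrSum p (fun q => if parities q = kk then F q else 0) -
        arrSum p F * arrSum p (fun q => if parities q = kk then 1 else 0)|
      ≤ env kk * (2 * sigmaStar m k n θ * arrSum p (fun q => if parities q = kk then 1 else 0)) :=
        mul_le_mul_of_nonneg_left hA (henv kk)
    _ = 2 * sigmaStar m k n θ * (env kk * arrSum p (fun q => if parities q = kk then 1 else 0)) := by ring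

/-! ### §5.2 The abstract endgame on a probability space -/

/-- A quantity within `t` of every value of `g` is within `t` of the mean of `g`. [folklore] -/
theorem abs_sub_integral_le {α : Type*} [MeasurableSpace α] (μ : Measure α) [IsProbabilityMeasure μ]
    (g : α → ℝ) (hg : Integrable g μ) (c t : ℝ) (h : ∀ x, |c - g x| ≤ t) :
    |c - ∫ x, g x ∂μ| ≤ t := by
  have h1 : c - ∫ x, g x ∂μ = ∫ x, (c - g x) ∂μ := by
    rw [integral_sub (integrable_const c) hg, integral_const, smul_eq_mul, probReal_univ, one_mul]
  rw [h1]
  have h2 := norm_integral_le_of_norm_le_const (μ := μ) (f := fun x => c - g x) (C := t)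
    (Filter.Eventually.of_forall fun x => by rw [Real.norm_eq_abs]; exact h x)
  rw [probReal_univ, mul_one, Real.norm_eq_abs] at h2
  exact h2

/-- THE ABSTRACT ENDGAME: if pointwise `|I − e g| ≤ s e` (screening), `g` oscillates by at most `t` (offsets)
and `e ≥ 0`, then `|∫ I − (∫ e)(∫ g)| ≤ (s + t) ∫ e`. [folklore] -/
theorem abs_integral_sub_mul_le {α : Type*} [MeasurableSpace α] (μ : Measure α) [IsProbabilityMeasure μ]
    (I e g : α → ℝ) (hI : Integrable I μ) (he : Integrable e μ) (hg : Integrable g μ) (s t : ℝ)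
    (he0 : ∀ x, 0 ≤ e x) (hscr : ∀ x, |I x - e x * g x| ≤ s * e x) (hoff : ∀ x y, |g x - g y| ≤ t) :
    |(∫ x, I x ∂μ) - (∫ x, e x ∂μ) * ∫ x, g x ∂μ| ≤ (s + t) * ∫ x, e x ∂μ := by
  have hgP : ∀ x, |g x - ∫ y, g y ∂μ| ≤ t := fun x => abs_sub_integral_le μ g hg (g x) t (hoff x)
  have hpt : ∀ x, |I x - e x * ∫ y, g y ∂μ| ≤ (s + t) * e x := fun x => by
    have h1 : I x - e x * ∫ y, g y ∂μ = (I x - e x * g x) + e x * (g x - ∫ y, g y ∂μ) := by ring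
    rw [h1]
    refine (abs_add_le _ _).trans ?_
    rw [abs_mul, abs_of_nonneg (he0 x), add_mul]
    exact add_le_add (hscr x) (by rw [mul_comm]; exact mul_le_mul_of_nonneg_right (hgP x) (he0 x))
  have h2 : (∫ x, I x ∂μ) - (∫ x, e x ∂μ) * ∫ x, g x ∂μ =
      ∫ x, (I x - e x * ∫ y, g y ∂μ) ∂μ := by
    rw [integral_sub hI (he.mul_const _), integral_mul_const]
  rw [h2]
  calc |∫ x, (I x - e x * ∫ y, g y ∂μ) ∂μ|
      ≤ ∫ x, |I x - e x * ∫ y, g y ∂μ| ∂μ := abs_integral_le_integral_abs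
    _ ≤ ∫ x, (s + t) * e x ∂μ :=
        integral_mono_of_nonneg (ae_of_all _ fun x => abs_nonneg _) (he.const_mul _) (ae_of_all _ hpt)
    _ = (s + t) * ∫ x, e x ∂μ := integral_const_mul _ _

/-! ### §5.3 Integrating out the internal plaquettes and the box coins -/

/-- `E[envE · boxInd]` after integrating out `(Qarr, Cbox)`: the integrand becomes
`arrSum p (q ↦ envE x (parities q) · Γ x (boxData q))`, `Γ` the coin average. [folklore] -/
theorem integral_env_box (S : Set ℤ) (a b : ℤ) (w h n m k : ℕ) (hm : m = w + 2 * n - 1)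
    (hk : k = h + 2 * n - 1) (hn : 1 ≤ n)
    (envE : Ω → (Fin m → Bool) × (Fin k → Bool) → ℝ)
    (bInd : Ω → (Fin w × Fin h → Bool) → (Fin w × Fin h → Bool) → ℝ)
    (henvm : ∀ kk, Measurable fun x => envE x kk) (henv : ∀ x kk, 0 ≤ envE x kk ∧ envE x kk ≤ 1)
    (hbm : ∀ t cc, Measurable fun x => bInd x t cc) (hb : ∀ x t cc, 0 ≤ bInd x t cc ∧ bInd x t cc ≤ 1) :
    ∫ ω, envE (projEnv a b w h n ω) (parities (Qarr S (a - n) (b - n) m k ω)) *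
        bInd (projEnv a b w h n ω) (boxData n w h (Qarr S (a - n) (b - n) m k ω)) (Cbox a b w h ω) ∂μIK =
      ∫ ω, arrSum (pcol S (a - n) m) (fun q => envE (projEnv a b w h n ω) (parities q) *
        ∑ cc, (1 / 2 : ℝ) ^ (w * h) * bInd (projEnv a b w h n ω) (boxData n w h q) cc) ∂μIK := by
  have key : ∫ ω, envE (projEnv a b w h n ω) (parities (Qarr S (a - n) (b - n) m k ω)) *
        bInd (projEnv a b w h n ω) (boxData n w h (Qarr S (a - n) (b - n) m k ω)) (Cbox a b w h ω) ∂μIK =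
      ∫ ω, (∑ q : Fin m × Fin k → Bool, ∑ cc : Fin w × Fin h → Bool,
        arrWeight (pcol S (a - n) m) q * (1 / 2) ^ (w * h) *
          (envE (projEnv a b w h n ω) (parities q) * bInd (projEnv a b w h n ω) (boxData n w h q) cc)) ∂μIK :=
    integral_env_arr_coins S a b w h n m k hm hk hn
      (fun x q cc => envE x (parities q) * bInd x (boxData n w h q) cc)
      (fun q cc => (henvm (parities q)).mul (hbm (boxData n w h q) cc))
      (fun x q cc => ⟨mul_nonneg (henv x _).1 (hb x _ _).1, mul_le_one₀ (henv x _).2 (hb x _ _).1 (hb x _ _).2⟩)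
  refine key.trans (integral_congr_ae (Filter.Eventually.of_forall fun ω => ?_))
  unfold arrSum
  beta_reduce
  refine Finset.sum_congr rfl fun q _ => ?_
  rw [Finset.mul_sum, Finset.mul_sum]
  exact Finset.sum_congr rfl fun cc _ => by ring

/-- `E[envE]` after integrating out `(Qarr, Cbox)`. [folklore] -/
theorem integral_env (S : Set ℤ) (a b : ℤ) (w h n m k : ℕ) (hm : m = w + 2 * n - 1)
    (hk : k = h + 2 * n - 1) (hn : 1 ≤ n)
    (envE : Ω → (Fin m → Bool) × (Fin k → Bool) → ℝ)
    (henvm : ∀ kk, Measurable fun x => envE x kk) (henv : ∀ x kk, 0 ≤ envE x kk ∧ envE x kk ≤ 1) :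
    ∫ ω, envE (projEnv a b w h n ω) (parities (Qarr S (a - n) (b - n) m k ω)) ∂μIK =
      ∫ ω, arrSum (pcol S (a - n) m) (fun q => envE (projEnv a b w h n ω) (parities q)) ∂μIK := by
  have key : ∫ ω, envE (projEnv a b w h n ω) (parities (Qarr S (a - n) (b - n) m k ω)) ∂μIK =
      ∫ ω, (∑ q : Fin m × Fin k → Bool, ∑ _cc : Fin w × Fin h → Bool,
        arrWeight (pcol S (a - n) m) q * (1 / 2) ^ (w * h) * envE (projEnv a b w h n ω) (parities q)) ∂μIK :=
    integral_env_arr_coins S a b w h n m k hm hk hn (fun x q _ => envE x (parities q))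
      (fun q _ => henvm (parities q)) (fun x q _ => henv x (parities q))
  refine key.trans (integral_congr_ae (Filter.Eventually.of_forall fun ω => ?_))
  unfold arrSum
  beta_reduce
  refine Finset.sum_congr rfl fun q _ => ?_
  calc ∑ _cc : Fin w × Fin h → Bool,
        arrWeight (pcol S (a - n) m) q * (1 / 2 : ℝ) ^ (w * h) * envE (projEnv a b w h n ω) (parities q)
      = (∑ _cc : Fin w × Fin h → Bool, (1 / 2 : ℝ) ^ (w * h)) *
          (arrWeight (pcol S (a - n) m) q * envE (projEnv a b w h n ω) (parities q)) := by
        rw [Finset.sum_mul]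
        exact Finset.sum_congr rfl fun _ _ => by ring
    _ = arrWeight (pcol S (a - n) m) q * envE (projEnv a b w h n ω) (parities q) := by
        rw [sum_half_pow, one_mul]

/-- `E[boxInd]` after integrating out `(Qarr, Cbox)`. [folklore] -/
theorem integral_box (S : Set ℤ) (a b : ℤ) (w h n m k : ℕ) (hm : m = w + 2 * n - 1)
    (hk : k = h + 2 * n - 1) (hn : 1 ≤ n)
    (bInd : Ω → (Fin w × Fin h → Bool) → (Fin w × Fin h → Bool) → ℝ)
    (hbm : ∀ t cc, Measurable fun x => bInd x t cc) (hb : ∀ x t cc, 0 ≤ bInd x t cc ∧ bInd x t cc ≤ 1) :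
    ∫ ω, bInd (projEnv a b w h n ω) (boxData n w h (Qarr S (a - n) (b - n) m k ω)) (Cbox a b w h ω) ∂μIK =
      ∫ ω, arrSum (pcol S (a - n) m) (fun q : Fin m × Fin k → Bool =>
        ∑ cc, (1 / 2 : ℝ) ^ (w * h) * bInd (projEnv a b w h n ω) (boxData n w h q) cc) ∂μIK := by
  have key : ∫ ω, bInd (projEnv a b w h n ω) (boxData n w h (Qarr S (a - n) (b - n) m k ω))
        (Cbox a b w h ω) ∂μIK =
      ∫ ω, (∑ q : Fin m × Fin k → Bool, ∑ cc : Fin w × Fin h → Bool,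
        arrWeight (pcol S (a - n) m) q * (1 / 2) ^ (w * h) *
          bInd (projEnv a b w h n ω) (boxData n w h q) cc) ∂μIK :=
    integral_env_arr_coins S a b w h n m k hm hk hn (fun x q cc => bInd x (boxData n w h q) cc)
      (fun q cc => hbm _ cc) (fun x q cc => hb x _ cc)
  refine key.trans (integral_congr_ae (Filter.Eventually.of_forall fun ω => ?_))
  unfold arrSum
  beta_reduce
  refine Finset.sum_congr rfl fun q _ => ?_
  rw [Finset.mul_sum]
  exact Finset.sum_congr rfl fun cc _ => by ring

/-! ### §5.4 The screening inequality for synthetic indicators -/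

/-- THE SCREENING INEQUALITY for synthetic statistics: for `[0, 1]`-valued, environment-measurable
`envE x kk` (far statistic, read through the parities) and `bInd x t cc` (box statistic, read through the box
data and the coins, the environment acting by additive offsets),
`|E[envE·bInd] − E[envE] E[bInd]| ≤ (2Σ* + (w + h) θ^n) E[envE]`. Integrate out `(Qarr, Cbox)`
(`integral_env_arr_coins`), screen pointwise in the environment (`screeningArray`), and replace the box average
by its mean up to the offset error (`screeningOffset`). [folklore] -/
theorem screening_master (S : Set ℤ) (a b : ℤ) (w h n : ℕ) (hn : 1 ≤ n)
    (hσ : sigmaStar (w + 2 * n - 1) (h + 2 * n - 1) n θIK ≤ 1)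
    (envE : Ω → (Fin (w + 2 * n - 1) → Bool) × (Fin (h + 2 * n - 1) → Bool) → ℝ)
    (bInd : Ω → (Fin w × Fin h → Bool) → (Fin w × Fin h → Bool) → ℝ)
    (henvm : ∀ kk, Measurable fun x => envE x kk) (henv : ∀ x kk, 0 ≤ envE x kk ∧ envE x kk ≤ 1)
    (hbm : ∀ t cc, Measurable fun x => bInd x t cc) (hb : ∀ x t cc, 0 ≤ bInd x t cc ∧ bInd x t cc ≤ 1)
    (hoff : ∀ x x' : Ω, ∃ (A : Fin w → Bool) (B : Fin h → Bool), ∀ t cc,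
      bInd x' t cc = bInd x (fun ij => xor (t ij) (xor (A ij.1) (B ij.2))) cc) :
    |(∫ ω, envE (projEnv a b w h n ω) (parities (Qarr S (a - n) (b - n) (w + 2 * n - 1) (h + 2 * n - 1) ω)) *
          bInd (projEnv a b w h n ω) (boxData n w h (Qarr S (a - n) (b - n) (w + 2 * n - 1) (h + 2 * n - 1) ω))
            (Cbox a b w h ω) ∂μIK) -
        (∫ ω, envE (projEnv a b w h n ω)
            (parities (Qarr S (a - n) (b - n) (w + 2 * n - 1) (h + 2 * n - 1) ω)) ∂μIK) *
          ∫ ω, bInd (projEnv a b w h n ω)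
            (boxData n w h (Qarr S (a - n) (b - n) (w + 2 * n - 1) (h + 2 * n - 1) ω)) (Cbox a b w h ω) ∂μIK| ≤
      (2 * sigmaStar (w + 2 * n - 1) (h + 2 * n - 1) n θIK + ((w : ℝ) + h) * θIK ^ n) *
        ∫ ω, envE (projEnv a b w h n ω)
          (parities (Qarr S (a - n) (b - n) (w + 2 * n - 1) (h + 2 * n - 1) ω)) ∂μIK := by
  haveI := CouplingToLimits.isProbabilityMeasure_μIK
  obtain ⟨hp, hpθ, hθ0, hθ1⟩ := pcol_props S (a - n) (w + 2 * n - 1)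
  have hnm : n ≤ w + 2 * n - 1 := by omega
  have hnk : n ≤ h + 2 * n - 1 := by omega
  rw [integral_env_box S a b w h n (w + 2 * n - 1) (h + 2 * n - 1) rfl rfl hn envE bInd henvm henv hbm hb,
    integral_env S a b w h n (w + 2 * n - 1) (h + 2 * n - 1) rfl rfl hn envE henvm henv,
    integral_box S a b w h n (w + 2 * n - 1) (h + 2 * n - 1) rfl rfl hn bInd hbm hb]
  set p := pcol S (a - n) (w + 2 * n - 1) with hpdef
  -- the coin average `Γ x t := Σ_cc 2^{-wh} bInd x t cc` and its properties
  have hΓ : ∀ x t, 0 ≤ ∑ cc, (1 / 2 : ℝ) ^ (w * h) * bInd x t cc ∧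
      ∑ cc, (1 / 2 : ℝ) ^ (w * h) * bInd x t cc ≤ 1 := fun x t => coinAvg_mem w h (bInd x t) (hb x t)
  have hΓm : ∀ t, Measurable fun x => ∑ cc, (1 / 2 : ℝ) ^ (w * h) * bInd x t cc := fun t =>
    Finset.measurable_sum _ fun cc _ => (hbm t cc).const_mul _
  -- measurability and integrability of the three integrands
  have hIm : Measurable fun x => arrSum p (fun q => envE x (parities q) *
      ∑ cc, (1 / 2 : ℝ) ^ (w * h) * bInd x (boxData n w h q) cc) := by
    unfold arrSum
    exact Finset.measurable_sum _ fun q _ => ((henvm (parities q)).mul (hΓm (boxData n w h q))).const_mul _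
  have hem : Measurable fun x => arrSum p (fun q => envE x (parities q)) := by
    unfold arrSum
    exact Finset.measurable_sum _ fun q _ => (henvm (parities q)).const_mul _
  have hgm : Measurable fun x => arrSum p (fun q : Fin (w + 2 * n - 1) × Fin (h + 2 * n - 1) → Bool =>
      ∑ cc, (1 / 2 : ℝ) ^ (w * h) * bInd x (boxData n w h q) cc) := by
    unfold arrSum
    exact Finset.measurable_sum _ fun q _ => (hΓm (boxData n w h q)).const_mul _
  have hbound : ∀ G : (Fin (w + 2 * n - 1) × Fin (h + 2 * n - 1) → Bool) → ℝ,
      (∀ q, 0 ≤ G q ∧ G q ≤ 1) → |arrSum p G| ≤ 1 := fun G hG =>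
    abs_arrSum_le_one p hp G fun q => abs_le.2 ⟨by linarith [(hG q).1], (hG q).2⟩
  have integ : ∀ F : Ω → ℝ, Measurable F → (∀ x, |F x| ≤ 1) →
      Integrable (fun ω => F (projEnv a b w h n ω)) μIK := fun F hF hF1 =>
    Integrable.of_bound ((hF.comp (measurable_projEnv a b w h n)).aestronglyMeasurable) 1
      (Filter.Eventually.of_forall fun ω => by rw [Real.norm_eq_abs]; exact hF1 _)
  have hI : Integrable (fun ω => arrSum p (fun q => envE (projEnv a b w h n ω) (parities q) *
      ∑ cc, (1 / 2 : ℝ) ^ (w * h) * bInd (projEnv a b w h n ω) (boxData n w h q) cc)) μIK :=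
    integ (fun x => arrSum p (fun q => envE x (parities q) *
      ∑ cc, (1 / 2 : ℝ) ^ (w * h) * bInd x (boxData n w h q) cc)) hIm fun x =>
        hbound (fun q => envE x (parities q) * ∑ cc, (1 / 2 : ℝ) ^ (w * h) * bInd x (boxData n w h q) cc)
          fun q => ⟨mul_nonneg (henv x _).1 (hΓ x _).1, mul_le_one₀ (henv x _).2 (hΓ x _).1 (hΓ x _).2⟩
  have he : Integrable (fun ω => arrSum p (fun q => envE (projEnv a b w h n ω) (parities q))) μIK :=
    integ (fun x => arrSum p (fun q => envE x (parities q))) hem fun x =>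
      hbound (fun q => envE x (parities q)) fun q => henv x _
  have hg : Integrable (fun ω => arrSum p (fun q : Fin (w + 2 * n - 1) × Fin (h + 2 * n - 1) → Bool =>
      ∑ cc, (1 / 2 : ℝ) ^ (w * h) * bInd (projEnv a b w h n ω) (boxData n w h q) cc)) μIK :=
    integ (fun x => arrSum p (fun q : Fin (w + 2 * n - 1) × Fin (h + 2 * n - 1) → Bool =>
      ∑ cc, (1 / 2 : ℝ) ^ (w * h) * bInd x (boxData n w h q) cc)) hgm fun x =>
        hbound (fun q : Fin (w + 2 * n - 1) × Fin (h + 2 * n - 1) → Bool =>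
          ∑ cc, (1 / 2 : ℝ) ^ (w * h) * bInd x (boxData n w h q) cc) fun q => hΓ x _
  refine abs_integral_sub_mul_le μIK _ _ _ hI he hg
    (2 * sigmaStar (w + 2 * n - 1) (h + 2 * n - 1) n θIK) (((w : ℝ) + h) * θIK ^ n) ?_ ?_ ?_
  · -- `0 ≤ e`
    intro ω
    exact Finset.sum_nonneg fun q _ => mul_nonneg (arrWeight_nonneg p hp q) (henv _ _).1
  · -- screening, pointwise in the environment
    intro ω
    exact screening_pointwise _ _ n hn hnm hnk p θIK hp hθ0 hθ1 hpθ hσ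
      (fun q => ∑ cc, (1 / 2 : ℝ) ^ (w * h) * bInd (projEnv a b w h n ω) (boxData n w h q) cc)
      (fun q => hΓ _ _)
      (fun q q' hqq' => congrArg (fun t => ∑ cc, (1 / 2 : ℝ) ^ (w * h) * bInd (projEnv a b w h n ω) t cc)
        (boxData_congr n w h q q' hqq'))
      (envE (projEnv a b w h n ω)) (fun kk => (henv _ kk).1)
  · -- offsets
    intro ω ω'
    obtain ⟨A, B, hAB⟩ := hoff (projEnv a b w h n ω) (projEnv a b w h n ω')
    have hγ' : arrSum p (fun q : Fin (w + 2 * n - 1) × Fin (h + 2 * n - 1) → Bool =>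
        ∑ cc, (1 / 2 : ℝ) ^ (w * h) * bInd (projEnv a b w h n ω') (boxData n w h q) cc) =
        arrSum p (fun q : Fin (w + 2 * n - 1) × Fin (h + 2 * n - 1) → Bool =>
          ∑ cc, (1 / 2 : ℝ) ^ (w * h) * bInd (projEnv a b w h n ω)
            (fun ij => xor (boxData n w h q ij) (xor (A ij.1) (B ij.2))) cc) := by
      simp only [hAB]
    have hoffset : |arrSum p (fun q : Fin (w + 2 * n - 1) × Fin (h + 2 * n - 1) → Bool =>
          ∑ cc, (1 / 2 : ℝ) ^ (w * h) * bInd (projEnv a b w h n ω) (boxData n w h q) cc) -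
        arrSum p (fun q : Fin (w + 2 * n - 1) × Fin (h + 2 * n - 1) → Bool =>
          ∑ cc, (1 / 2 : ℝ) ^ (w * h) * bInd (projEnv a b w h n ω)
            (fun ij => xor (boxData n w h q ij) (xor (A ij.1) (B ij.2))) cc)| ≤ ((w : ℝ) + h) * θIK ^ n :=
      screeningOffset n w h hn p θIK hp hθ0 hθ1 hpθ
        (fun t => ∑ cc, (1 / 2 : ℝ) ^ (w * h) * bInd (projEnv a b w h n ω) t cc) (hΓ _) A B
    calc _ = _ := congrArg (fun z => |arrSum p (fun q : Fin (w + 2 * n - 1) × Fin (h + 2 * n - 1) → Bool =>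
          ∑ cc, (1 / 2 : ℝ) ^ (w * h) * bInd (projEnv a b w h n ω) (boxData n w h q) cc) - z|) hγ'
      _ ≤ _ := hoffset

end Summit.CriticalPhenomena.CardyFormulaZ2.Theorems.IKLinearTransport.PinnedDiagramExchange.ScreeningAssembly
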